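import Mathlib
import Literature.AlgebraicGeometry.Resolution.PolygonChartTransportIndexed
import HarnessLib

/-!
# The polygon at the origin of the `u₂`-chart of a point blow-up, ARBITRARY embedding dimension: `α″ = α`, `β″ ≤ α + β − 1`

Topic: `Literature/AlgebraicGeometry/Resolution`. Dimension-general form of `ChartTwoPolygonLaws.lean` (`c : Fin 3 → R`, proved there through the
`u₁ ↔ u₂` symmetry `PolygonSymmetry`): eighth brick of the generalisation `Fin 3 → Fin (r+2)` of the tree's expansion-free rendering of
Hironaka's characteristic polyhedra (memo `run/shared/lean/pub/res-hironaka/L/res-L1-w42-stub-3/KEYCLAIM-PORT-PLAN.md` §4–§5). Here the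
laws are proved DIRECTLY in the pivot-general chart setting of `PolygonChartTransportIndexed` with pivot `u2 r` (no symmetry file is needed).
Cossart–Jannsen–Saito, LNM 2270, **Lemma 12.2 (3)**: at the origin `x″` of the `u₂`-chart (parameters `(z′ = y/u₂, u₁′ = u₁/u₂, u₂)`), the weak
transform `J″ = (J R″ : u₂^μ)` of an idealistic exponent `(J, μ)` with `δ(J) > 1` has `α(J″) = α(J)` and `β(J″) ≤ α(J) + β(J) − 1` (the map
`Φ(a₁, a₂) = (a₁, a₁ + a₂ − 1)`); whence Lemma 13.4 (3) / Cossart–Piltant (16): `β″ < β` when `α < 1`. For the SCALED integer invariants of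
`PolygonInvariantsIndexed`.

* `levelWeight_eq_pullbackWeightAt_u2`, `forall_pts_colon_of_forall_pts_u2` (transport of half-planes through the `u₂`-chart),
  `alphaS_le_spt₁_colon_u2` (new abscissae `≥ α`), `exists_pts_colon_u2_v` (the vertex `v = (α, β)` goes up to `Φ(v) = (α, α + β − 1)`);
* **laws** `alphaS_colon_u2_eq` (`αs″ = αs`), `betaS_colon_u2_add_le` (`βs″ + L ≤ αs + βs`), `betaS_colon_u2_lt` (`αs < L ⇒ βs″ < βs`).

Sources: V. Cossart, U. Jannsen, S. Saito, LNM **2270** (2020), Lemma 12.2 (3), Lemma 13.4 (2)–(3) [`CossartJannsenSaito2020`]; V. Cossart,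
O. Piltant, J. Algebra 320 (2008), proof of Lemma 4.5, p. 12, (16) [`CossartPiltant2008`]. No named facts; no instance, notation or attribute.
-/

noncomputable section

open IsLocalRing MvPolynomial

namespace Literature.AlgebraicGeometry.Resolution

namespace WeightedOrder

universe u

section Chart

variable {R R' : Type u} [CommRing R] [CommRing R'] (φ : R →+* R') {r : ℕ} {c : Fin (r + 2) → R}
  {c' : Fin (r + 2) → R'} (hpiv : c' (u2 r) = φ (c (u2 r))) (hoth : ∀ i, i ≠ u2 r → φ (c i) = φ (c (u2 r)) * c' i)
  [IsRegularLocalRing R] [IsRegularLocalRing R']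
  (hgen : Ideal.span (Set.range c) = maximalIdeal R) (hdim : ringKrullDim R = r + 2)
  (hgen' : Ideal.span (Set.range c') = maximalIdeal R') (hdim' : ringKrullDim R' = r + 2)
  {J : Ideal R} {μ : ℕ}

/-- The level weight `(w₀′ + L p₂′, …, L (p₁′ + p₂′), L p₂′)` is the pull-back through the `u₂`-chart of the level weight
`(w₀′, …, L p₁′, L p₂′)`. [cite: CossartJannsenSaito2020, Lemma 12.2 (3)] -/
theorem levelWeight_eq_pullbackWeightAt_u2 (μ w₀' p₁' p₂' : ℕ) :
    levelWeight (r := r) μ (w₀' + μ.factorial * p₂') (p₁' + p₂') p₂' =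
      pullbackWeightAt (u2 r) (levelWeight μ w₀' p₁' p₂') := by
  funext i
  by_cases hi : i = u2 r
  · subst hi; rw [pullbackWeightAt_self, levelWeight_u2, levelWeight_u2]
  · rw [pullbackWeightAt_of_ne _ hi, levelWeight_u2]
    revert hi
    refine Fin.addCases (fun k hk => ?_) (fun k hk => ?_) i
    · rw [levelWeight_y, levelWeight_y]
    · fin_cases k
      · change levelWeight μ _ (p₁' + p₂') p₂' (u1 r) = levelWeight μ w₀' p₁' p₂' (u1 r) + _
        rw [levelWeight_u1, levelWeight_u1]; ring
      · exact absurd rfl hk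

include hpiv hoth hgen hdim hgen' hdim' in
/-- **Transport of half-planes through the `u₂`-chart** («`Δ″ ⊆` minimal `F`-subset containing `Φ(Δ)`», `Φ(a₁, a₂) = (a₁, a₁ + a₂ − 1)`): if
every point of `pts c J μ` satisfies `(p₁′ + p₂′) x₁ + p₂′ x₂ ≥ w₀′ + L p₂′`, then every point of `pts c′ J″ μ` satisfies `p₁′ x₁ + p₂′ x₂ ≥ w₀′`
(`w₀′, p₁′, p₂′ > 0`). [cite: CossartJannsenSaito2020, Lemma 12.2 (3)] -/
theorem forall_pts_colon_of_forall_pts_u2 {w₀' p₁' p₂' : ℕ} (hw₀' : 0 < w₀') (hp₁' : 0 < p₁') (hp₂' : 0 < p₂')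
    (hS : ∀ e ∈ pts c J μ, w₀' + μ.factorial * p₂' ≤ (p₁' + p₂') * spt₁ μ e + p₂' * spt₂ μ e) :
    ∀ e' ∈ pts c' ((J.map φ).colon {φ (c (u2 r)) ^ μ}) μ, w₀' ≤ p₁' * spt₁ μ e' + p₂' * spt₂ μ e' := by
  have hJ : J ≤ weightedOrderIdeal c (levelWeight μ (w₀' + μ.factorial * p₂') (p₁' + p₂') p₂')
      ((w₀' + μ.factorial * p₂') * μ) :=
    (le_weightedOrderIdeal_levelWeight_iff c hgen hdim J (by omega) (by omega) hp₂').mpr hS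
  rw [levelWeight_eq_pullbackWeightAt_u2] at hJ
  have hlev : (w₀' + μ.factorial * p₂') * μ = w₀' * μ + μ * (levelWeight μ w₀' p₁' p₂' (u2 r)) := by
    rw [levelWeight_u2]; ring
  rw [hlev] at hJ
  have hW' := levelWeight_pos (r := r) (μ := μ) hw₀' hp₁' hp₂'
  have hJ' := colon_le_weightedOrderIdeal_of_le_chartAt φ (u2 r) hpiv hoth _ hgen' hdim' hW' hJ
  exact (le_weightedOrderIdeal_levelWeight_iff c' hgen' hdim' _ hw₀' hp₁' hp₂').mp hJ'

include hpiv hoth hgen hdim hgen' hdim' in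
/-- **New abscissae are `≥ α`**: every point of the weak transform in the `u₂`-chart has `spt₁″ ≥ αs` (for `δ > 1`).
[cite: CossartJannsenSaito2020, Lemma 12.2 (3)] -/
theorem alphaS_le_spt₁_colon_u2 (hδ : μ.factorial < deltaS c J μ) {e' : Fin (r + 2) →₀ ℕ}
    (he' : e' ∈ pts c' ((J.map φ).colon {φ (c (u2 r)) ^ μ}) μ) : alphaS c J μ ≤ spt₁ μ e' := by
  by_contra hlt
  push Not at hlt
  -- transport the half-planes `N x₁ + x₂ ≥ N αs + δs − L`
  set N := spt₂ μ e' + 1 with hN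
  have h := forall_pts_colon_of_forall_pts_u2 φ hpiv hoth hgen hdim hgen' hdim'
    (w₀' := N * alphaS c J μ + (deltaS c J μ - μ.factorial)) (p₁' := N) (p₂' := 1)
    (by omega) (by omega) Nat.one_pos (fun e he => by
      have h1 := deltaS_le he
      have h2 := alphaS_le he
      have h3 : N * alphaS c J μ ≤ N * spt₁ μ e := Nat.mul_le_mul_left _ h2
      have h4 : (N + 1) * spt₁ μ e = N * spt₁ μ e + spt₁ μ e := by ring
      rw [h4]
      omega) e' he'
  have h3 : N * (spt₁ μ e' + 1) ≤ N * alphaS c J μ := Nat.mul_le_mul_left _ hlt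
  rw [Nat.mul_add, mul_one] at h3
  omega

include hpiv hoth hgen hdim hgen' hdim' in
/-- **Realisation of `v`**: the vertex `v = (α, β)` of `Δ(J)` goes up to the point `Φ(v) = (α, α + β − 1)` of the weak transform in the
`u₂`-chart (`δ > 1`, `J ⊆ 𝔪^μ`). [cite: CossartJannsenSaito2020, Lemma 12.2 (3)] -/
theorem exists_pts_colon_u2_v (hJμ : J ≤ maximalIdeal R ^ μ) (hne : (pts c J μ).Nonempty) (hδ : μ.factorial < deltaS c J μ) :
    ∃ e' ∈ pts c' ((J.map φ).colon {φ (c (u2 r)) ^ μ}) μ,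
      spt₁ μ e' = alphaS c J μ ∧ spt₂ μ e' + μ.factorial = alphaS c J μ + betaS c J μ := by
  obtain ⟨e, he, h1, h2⟩ := exists_pts_v hne
  set N := betaS c J μ + 2 with hN
  -- `e` minimises `ℓ = N spt₁ + spt₂`
  have hmin : ∀ x ∈ pts c J μ, N * spt₁ μ e + 1 * spt₂ μ e ≤ N * spt₁ μ x + 1 * spt₂ μ x := by
    have key := isMinOn_lex (S := pts c J μ) (ℓ₁ := spt₁ μ) (ℓ₂ := spt₂ μ) (e := e)
      (fun x hx => by rw [h1]; exact alphaS_le hx)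
      (fun x hx hx1 => by rw [h2]; exact betaS_le hx (by rw [hx1, h1]))
    intro x hx
    have hkx := key x hx
    rw [h2] at hkx ⊢
    have hax : alphaS c J μ ≤ spt₁ μ x := alphaS_le hx
    rw [← h1] at hax
    have hsplit : ∀ t : ℕ, N * t = (betaS c J μ + 1) * t + t := by intro t; rw [hN]; ring
    rw [hsplit, hsplit]
    omega
  have hℓ : N * spt₁ μ e + 1 * spt₂ μ e = N * alphaS c J μ + betaS c J μ := by rw [← h1, ← h2]; ring
  have hδv := deltaS_le_alphaS_add_betaS hne
  have hNα : alphaS c J μ ≤ N * alphaS c J μ := Nat.le_mul_of_pos_left _ (by omega)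
  have hpos : 0 < N * spt₁ μ e + 1 * spt₂ μ e := by rw [hℓ]; omega
  obtain ⟨f, hf, hinit⟩ := exists_isInitialTerm_levelWeight_of_isMinOn c hgen hdim (by omega) Nat.one_pos he hmin hpos
  have hsub : μ.factorial * 1 ≤ N * spt₁ μ e + 1 * spt₂ μ e := by rw [hℓ]; omega
  set w₀' := N * spt₁ μ e + 1 * spt₂ μ e - μ.factorial * 1 with hw₀'
  have hwt : levelWeight μ (N * spt₁ μ e + 1 * spt₂ μ e) N 1 = pullbackWeightAt (u2 r) (levelWeight μ w₀' (N - 1) 1) := by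
    have hN1 : (N - 1) + 1 = N := by omega
    have := levelWeight_eq_pullbackWeightAt_u2 (r := r) μ w₀' (N - 1) 1
    rw [hN1, hw₀', Nat.sub_add_cancel hsub] at this
    exact this
  rw [hwt] at hinit
  have hW' : ∀ i : Fin (r + 2), 0 < levelWeight μ w₀' (N - 1) 1 i := by
    refine levelWeight_pos ?_ (by omega) Nat.one_pos
    rw [hw₀', hℓ]
    omega
  refine ⟨chartPtAt (u2 r) μ e, chartPtAt_mem_pts_u2 φ _ hgen hdim hgen' hdim' hW' hpiv hoth hJμ hf he.2 hinit, ?_, ?_⟩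
  · rw [spt₁_chartPtAt_u2, h1]
  · have := spt₂_chartPtAt_u2_add he.2 (le_degree_of_mem_occ c hgen hdim hJμ he.1)
    omega

include hpiv hoth hgen hdim hgen' hdim' in
/-- **CJS Lemma 12.2 (3), first law**: `α(J″) = α(J)` (scaled: `αs″ = αs`). [cite: CossartJannsenSaito2020, Lemma 12.2 (3)] -/
theorem alphaS_colon_u2_eq (hJμ : J ≤ maximalIdeal R ^ μ) (hne : (pts c J μ).Nonempty) (hδ : μ.factorial < deltaS c J μ) :
    alphaS c' ((J.map φ).colon {φ (c (u2 r)) ^ μ}) μ = alphaS c J μ := by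
  obtain ⟨e', he', h1, -⟩ := exists_pts_colon_u2_v φ hpiv hoth hgen hdim hgen' hdim' hJμ hne hδ
  have hne' : (pts c' ((J.map φ).colon {φ (c (u2 r)) ^ μ}) μ).Nonempty := ⟨e', he'⟩
  refine le_antisymm ?_ ?_
  · rw [← h1]; exact alphaS_le he'
  · obtain ⟨a, ha, ha1⟩ := exists_pts_alphaS hne'
    rw [← ha1]
    exact alphaS_le_spt₁_colon_u2 φ hpiv hoth hgen hdim hgen' hdim' hδ ha

include hpiv hoth hgen hdim hgen' hdim' in
/-- **CJS Lemma 12.2 (3), second law**: `β(J″) ≤ α(J) + β(J) − 1` (scaled: `βs″ + L ≤ αs + βs`).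
[cite: CossartJannsenSaito2020, Lemma 12.2 (3)] [cite: CossartPiltant2008, proof of Lemma 4.5, p. 12] -/
theorem betaS_colon_u2_add_le (hJμ : J ≤ maximalIdeal R ^ μ) (hne : (pts c J μ).Nonempty) (hδ : μ.factorial < deltaS c J μ) :
    betaS c' ((J.map φ).colon {φ (c (u2 r)) ^ μ}) μ + μ.factorial ≤ alphaS c J μ + betaS c J μ := by
  obtain ⟨e', he', h1, h2⟩ := exists_pts_colon_u2_v φ hpiv hoth hgen hdim hgen' hdim' hJμ hne hδ
  have hα := alphaS_colon_u2_eq φ hpiv hoth hgen hdim hgen' hdim' hJμ hne hδ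
  have := betaS_le he' (by rw [h1, hα])
  omega

include hpiv hoth hgen hdim hgen' hdim' in
/-- **CJS Lemma 12.2 (5) / 13.4 (3), Cossart–Piltant (16): `β` strictly drops at the origin of the `u₂`-chart when `α < 1`** (scaled:
`αs < L ⇒ βs″ < βs`; `α < 1` is quasi-isolation, Lemma 11.5). [cite: CossartJannsenSaito2020, Lemma 13.4 (3)] [cite: CossartPiltant2008, (16)] -/
theorem betaS_colon_u2_lt (hJμ : J ≤ maximalIdeal R ^ μ) (hne : (pts c J μ).Nonempty) (hδ : μ.factorial < deltaS c J μ)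
    (hα : alphaS c J μ < μ.factorial) : betaS c' ((J.map φ).colon {φ (c (u2 r)) ^ μ}) μ < betaS c J μ := by
  have := betaS_colon_u2_add_le φ hpiv hoth hgen hdim hgen' hdim' hJμ hne hδ
  omega

end Chart

end WeightedOrder

end Literature.AlgebraicGeometry.Resolution

end
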